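import Summits.AtomisticToContinuum.BoseEinsteinCondensation.Theorems.BECThomsonPrincipleGDTransferSeededLawDilation
import Summits.AtomisticToContinuum.BoseEinsteinCondensation.Theorems.BECThomsonPrincipleGDTransferSeededNearMinPhase
import Summits.AtomisticToContinuum.BoseEinsteinCondensation.Theorems.BECInsertionCorrectorCorrectorClosureVolumeBootstrapDilation
import Summits.AtomisticToContinuum.BoseEinsteinCondensation.Theorems.BECThomsonPrincipleGDTransferSeededGradingDefs

/-!
# Route `BECThomsonPrinciple`, crux `GDTransfer` (stmt-AtomisticToContinuum-9482), line `seeded-continuity` —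
# registered stub `lawLocalConstancy` (fixed-`N` seed programme): local constancy in the side of the WHOLE
# `n̂₀`-law of near-minimisers

Supports (does not close) stmt-AtomisticToContinuum-9482.

**Statement** (`CountLaw → ∀ v, IsRepulsiveFiniteRange v → IsFiniteContinuous v → LawLocalConstancy v`).
At fixed particle number `N = m + 1`, for every decidable set of counts `p`, every side `L₁ > 0` and every
`ε > 0` there are a radius `r > 0` and a slack `δ₁ > 0` such that for every side `L'` with `|L' − L₁| < r`
some slack `δ' > 0` makes the partial law `P(n̂₀ ∈ p) = lawMass p` of every `δ'`-near-minimiser at `L'` and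
of every `δ₁`-near-minimiser at `L₁` agree within `ε`.  This is the landed `stub_localConstancy`
(`…SeededLocalConstancy`, the instance `p = ((1−β)N ≤ ·)`) for an arbitrary set of counts, with the same proof.

**Proof** (the near-minimiser / `Q_S`-law version of the tree's `vb_localConstancy`).
* Symmetrise the profile, `u r = v|r|` (same energies, bounded on `ℝ` by
  `exists_bound_of_continuous_finiteRange`).
* LAW STABILITY at `(N, L₁)` (`lawMass_toReal_close_of_nearMinimisers`, from
  `lawMass_le_of_nearMinimisers`, stated for a general predicate: spectral gap + phase alignment give
  `∫|Θ − cΞ|² ≤ η²` for two `δ`-near-minimisers, and the `L²`-Lipschitz bound of the law — HYPOTHESIS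
  `CountLaw` (2) — with the phase covariance `w_S(cΞ) = w_S(Ξ)` gives `|lawMass Θ − lawMass Ξ| ≤ 2η + η² ≤ ε`;
  the masses are `≤ 1` by `CountLaw` (1), so the bound passes to `toReal`).
* TRANSPORT: for `|L' − L₁| < r = min(L₁/2, η_T L₁/2)` put `b = L₁/L'` (`|b − 1| < η_T`) and dilate,
  `Φ = Ψ'_b` (`PeriodicTrialState.dilate`): `lawMass Φ = lawMass Ψ'` (`lawMass_dilate`),
  `E_{b⁻²u(·/b)}(Φ) = b⁻²E_u(Ψ') ≤ E₀(b⁻²u(·/b), L₁) + δ'/2` for a `b²δ'/2`-near-minimiser `Ψ'`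
  (`periodicEnergy_dilate`, `periodicGroundStateEnergy_scaledPotential`), and the two interactions on the torus
  of side `L₁` are `D = N²ε'C`-close both ways (`vb_scaledPotential_close` for the finite continuous class,
  `vb_periodizedPotential_le_of_pointwise`, `exists_bound_periodizedPotential`,
  `vb_periodicInteraction_le_of_periodized_le`), so `Φ` is a `(2D + δ'/2) ≤ δ'`-near-minimiser of `u` at `L₁`
  (`vb_periodicEnergy_le_of_interaction_le`, `vb_groundStateEnergy_le_of_interaction_le`); with `δ' ≤ δ` and
  `δ₁ = δ'` law stability applies to `(Φ, Ψ₁)`.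

## References

* [LSSY2005] E. H. Lieb, R. Seiringer, J. P. Solovej, J. Yngvason, *The Mathematics of the Bose Gas and
  its Condensation*, Birkhäuser (2005): Ch. 5, footnote to (5.3) (scaling of the torus problem).
* [ReedSimonIV1978] M. Reed, B. Simon, *Methods of Modern Mathematical Physics IV*, Academic Press (1978),
  Thm XIII.1 and §XIII.12 (nondegenerate ground states).
-/

noncomputable section

open MeasureTheory Filter Set Metric
open scoped ENNReal NNReal

namespace Summit.AtomisticToContinuum.BoseEinsteinCondensation.Cruxes.GDTransfer.Seeded

open Literature.MathematicalPhysics.QuantumManyBody.BoseGas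
open Literature.Barriers.AtomisticToContinuum.BoseGas (scaledPotential periodicEnergy_dilate
  periodicGroundStateEnergy_scaledPotential)
open Summit.AtomisticToContinuum.BoseEinsteinCondensation.Theorems (exists_bound_of_continuous_finiteRange
  exists_bound_periodizedPotential)
open Summit.AtomisticToContinuum.BoseEinsteinCondensation.Theorems.CorrectorClosure.VolumeHomotopySumRuleDomination
  (vb_periodizedPotential_le_of_pointwise vb_periodicInteraction_le_of_periodized_le
    vb_periodicEnergy_le_of_interaction_le vb_groundStateEnergy_le_of_interaction_le vb_scaledPotential_close)

/-! ## Law stability at fixed `(N, L)`, two-sided and in `ℝ` -/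

/-- **The partial laws `P(n̂₀ ∈ p)` of two near-minimisers agree within `ε`** (fixed `(N, L)`, measurable
bounded finite-range `u`, an arbitrary decidable set of counts `p`, given `CountLaw`): two-sided real form of
`lawMass_le_of_nearMinimisers`; the masses are finite because they are bounded by the total mass `Σ_S w_S = 1`
(`CountLaw` (1)). [folklore] -/
theorem lawMass_toReal_close_of_nearMinimisers (hC : CountLaw) {u : ℝ → ℝ≥0∞} (hmeas : Measurable u)
    {R₀ : ℝ} (hR₀ : ∀ r, R₀ < r → u r = 0) {M : ℝ≥0} (hM : ∀ r, u r ≤ M) (m : ℕ) {L : ℝ} (hL : 0 < L)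
    (p : ℕ → Prop) [DecidablePred p] {ε : ℝ} (hε : 0 < ε) :
    ∃ δ : ℝ≥0∞, 0 < δ ∧ ∀ Θ Ξ : PeriodicTrialState (m + 1) L,
      periodicEnergy u Θ ≤ periodicGroundStateEnergy u (m + 1) L + δ →
      periodicEnergy u Ξ ≤ periodicGroundStateEnergy u (m + 1) L + δ →
      (lawMass m L p Θ.ψ).toReal ≤ (lawMass m L p Ξ.ψ).toReal + ε ∧
        (lawMass m L p Ξ.ψ).toReal ≤ (lawMass m L p Θ.ψ).toReal + ε := by
  obtain ⟨δ, hδ0, hδ⟩ := lawMass_le_of_nearMinimisers hC hmeas hR₀ hM m hL p hε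
  have hfin : ∀ Θ : PeriodicTrialState (m + 1) L, lawMass m L p Θ.ψ ≠ ⊤ := fun Θ => by
    refine ne_top_of_le_ne_top ENNReal.one_ne_top ?_
    have h1 := (hC.1 m L hL Θ).1
    unfold lawMass
    rw [← h1]
    exact Finset.sum_le_sum_of_subset (Finset.filter_subset _ _)
  have hreal : ∀ Θ Ξ : PeriodicTrialState (m + 1) L,
      lawMass m L p Θ.ψ ≤ lawMass m L p Ξ.ψ + ENNReal.ofReal ε →
      (lawMass m L p Θ.ψ).toReal ≤ (lawMass m L p Ξ.ψ).toReal + ε := fun Θ Ξ h => by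
    have h2 := ENNReal.toReal_mono (ENNReal.add_ne_top.2 ⟨hfin Ξ, ENNReal.ofReal_ne_top⟩) h
    rwa [ENNReal.toReal_add (hfin Ξ) ENNReal.ofReal_ne_top, ENNReal.toReal_ofReal hε.le] at h2
  exact ⟨δ, hδ0, fun Θ Ξ hΘ hΞ => ⟨hreal Θ Ξ (hδ Θ Ξ hΘ hΞ), hreal Ξ Θ (hδ Ξ Θ hΞ hΘ)⟩⟩

/-! ## The stub -/

/-- **Registered stub `lawLocalConstancy`** (line `seeded-continuity` of crux `GDTransfer`,
stmt-AtomisticToContinuum-9482, fixed-`N` seed programme): local constancy in the side `L` of the whole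
`n̂₀`-law `P(n̂₀ ∈ p)` of the near-minimisers, for finite continuous repulsive finite-range profiles and every
decidable set of counts `p`, given the count law. Dilation transport (`PeriodicTrialState.dilate`,
`lawMass_dilate`, `vb_scaledPotential_close`) + near-minimiser law stability at `(N, L₁)`
(`lawMass_toReal_close_of_nearMinimisers`). [cite: LSSY2005, Ch. 5, footnote to (5.3)] -/
theorem lawLocalConstancy : CountLaw → ∀ v : ℝ → ENNReal, Literature.MathematicalPhysics.QuantumManyBody.BoseGas.IsRepulsiveFiniteRange v → IsFiniteContinuous v → LawLocalConstancy v := by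
  intro hC v hv hfc m p _ L₁ hL₁ ε hε
  obtain ⟨hmeas, R₀, hR₀⟩ := hv
  obtain ⟨hfin, hcont⟩ := hfc
  -- the symmetrised profile `u r = v |r|`: same energies, bounded on all of `ℝ`
  set u : ℝ → ℝ≥0∞ := fun r => v |r| with hu
  have hu_meas : Measurable u := hmeas.comp continuous_abs.measurable
  have hu_fin : ∀ r, u r ≠ ⊤ := fun r => hfin _
  have hu_cont : Continuous fun x : Space => (u ‖x‖).toReal := by
    simp only [hu, abs_norm]
    exact hcont
  have huR : ∀ r, R₀ < r → u r = 0 := fun r hr => hR₀ _ (hr.trans_le (le_abs_self r))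
  obtain ⟨M, hM⟩ := exists_bound_of_continuous_finiteRange hu_fin hu_cont huR
  have huM : ∀ r, u r ≤ M := fun r => by
    have h := hM (EuclideanSpace.single 0 r)
    have hn : ‖EuclideanSpace.single (0 : Fin 3) r‖ = |r| := by
      rw [EuclideanSpace.norm_eq]
      simp [Real.sqrt_sq_eq_abs]
    rw [hn] at h
    simpa only [hu, abs_abs] using h
  have hE : ∀ {L : ℝ} (Φ : PeriodicTrialState (m + 1) L), periodicEnergy u Φ = periodicEnergy v Φ := by
    intro L Φ
    unfold periodicEnergy periodicInteraction periodizedPotential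
    simp only [hu, abs_norm]
  have hE₀ : ∀ L : ℝ, periodicGroundStateEnergy u (m + 1) L = periodicGroundStateEnergy v (m + 1) L :=
    fun L => by
    unfold periodicGroundStateEnergy
    exact iInf_congr fun Φ => hE Φ
  -- law stability at `(N, L₁)` for `u`, tolerance `δ`, and a real `δ' > 0` below it
  obtain ⟨δ, hδ0, hδ⟩ := lawMass_toReal_close_of_nearMinimisers hC hu_meas huR huM m hL₁ p hε
  obtain ⟨δ', hδ'0, hδ'⟩ : ∃ δ' : ℝ, 0 < δ' ∧ ENNReal.ofReal δ' ≤ δ := by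
    obtain ⟨q, _, hq1, hq2⟩ := ENNReal.lt_iff_exists_real_btwn.1 hδ0
    exact ⟨q, ENNReal.ofReal_pos.1 hq1, hq2.le⟩
  set δh : ℝ := δ' / 2 with hδh
  have hδh0 : 0 < δh := by positivity
  -- the number of lattice images within `2R` is bounded at side `L₁`
  set R := max R₀ 0 with hR
  set cut : ℝ → ℝ≥0∞ := (Set.Iic (2 * R)).indicator (1 : ℝ → ℝ≥0∞) with hcut
  have hcut1 : ∀ r, cut r ≤ (1 : ℝ≥0) := fun r => by
    rw [hcut, ENNReal.coe_one]
    exact Set.indicator_apply_le' (fun _ => le_rfl) fun _ => zero_le_one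
  have hcutR : ∀ r, 2 * R < r → cut r = 0 := fun r hr =>
    Set.indicator_of_notMem (show r ∉ Set.Iic (2 * R) from not_le.2 hr) _
  obtain ⟨C, hC'⟩ := exists_bound_periodizedPotential hL₁ hcut1 hcutR
  -- `ε'` with `2N²ε'C ≤ δ'/2`
  set ε' : ℝ := δh / (2 * (((m + 1) * (m + 1) : ℕ) : ℝ) * C + 2) with hε'
  have hε'0 : 0 < ε' := by positivity
  have hD : 2 * ((((m + 1) * (m + 1) : ℕ) : ℝ≥0∞) * (ENNReal.ofReal ε' * C)) ≤ ENNReal.ofReal δh := by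
    have h1 : 2 * ((((m + 1) * (m + 1) : ℕ) : ℝ≥0∞) * (ENNReal.ofReal ε' * C)) =
        ENNReal.ofReal (2 * ((((m + 1) * (m + 1) : ℕ) : ℝ) * (ε' * C))) := by
      rw [ENNReal.ofReal_mul (by norm_num), ENNReal.ofReal_mul (Nat.cast_nonneg _),
        ENNReal.ofReal_mul hε'0.le, ENNReal.ofReal_ofNat, ENNReal.ofReal_natCast,
        ENNReal.ofReal_coe_nnreal]
    rw [h1]
    refine ENNReal.ofReal_le_ofReal ?_
    have hC0 : (0 : ℝ) ≤ C := C.coe_nonneg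
    have hNN : (0 : ℝ) ≤ (((m + 1) * (m + 1) : ℕ) : ℝ) := Nat.cast_nonneg _
    rw [hε', show (2 : ℝ) * ((((m + 1) * (m + 1) : ℕ) : ℝ) *
        (δh / (2 * (((m + 1) * (m + 1) : ℕ) : ℝ) * C + 2) * C)) =
        δh * ((2 * (((m + 1) * (m + 1) : ℕ) : ℝ) * C) / (2 * (((m + 1) * (m + 1) : ℕ) : ℝ) * C + 2)) by
          ring]
    refine mul_le_of_le_one_right hδh0.le ?_
    rw [div_le_one (by positivity)]
    linarith
  -- `η_T` from the uniform closeness of `b⁻²u(·/b)` and `u`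
  obtain ⟨ηT, hηT0, hηT⟩ := vb_scaledPotential_close hu_fin hu_cont huR hε'0
  -- the radius and the slack at `L₁`
  refine ⟨min (L₁ / 2) (ηT * L₁ / 2), by positivity, ENNReal.ofReal δ', ENNReal.ofReal_pos.2 hδ'0,
    fun L' hL' => ?_⟩
  have hr1 : |L' - L₁| < L₁ / 2 := hL'.trans_le (min_le_left _ _)
  have hr2 : |L' - L₁| < ηT * L₁ / 2 := hL'.trans_le (min_le_right _ _)
  have hL'ge : L₁ / 2 < L' := by linarith [(abs_lt.1 hr1).1]
  have hL'pos : 0 < L' := by linarith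
  set b : ℝ := L₁ / L' with hb
  have hb0 : 0 < b := div_pos hL₁ hL'pos
  have hbL : L₁ = b * L' := by rw [hb, div_mul_cancel₀ _ hL'pos.ne']
  have hb1 : |b - 1| < ηT := by
    rw [hb, show L₁ / L' - 1 = (L₁ - L') / L' by field_simp, abs_div, abs_of_pos hL'pos,
      div_lt_iff₀ hL'pos, abs_sub_comm]
    calc |L' - L₁| < ηT * L₁ / 2 := hr2
      _ = ηT * (L₁ / 2) := by ring
      _ ≤ ηT * L' := by gcongr
  have hb2 : ENNReal.ofReal (b ^ 2) ≠ 0 := by simpa using hb0.ne'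
  -- the slack at `L'`: `b² δ'/2`
  refine ⟨ENNReal.ofReal (b ^ 2) * ENNReal.ofReal δh,
    ENNReal.mul_pos hb2 (ENNReal.ofReal_pos.2 hδh0).ne', fun Ψ' Ψ₁ hΨ' hΨ₁ => ?_⟩
  -- the dilated state: same `lawMass`, near-minimiser of the scaled potential at side `L₁`
  set Φ : PeriodicTrialState (m + 1) L₁ := Ψ'.dilate b hb0 hbL with hΦ
  have hmass : lawMass m L₁ p Φ.ψ = lawMass m L' p Ψ'.ψ := lawMass_dilate hb0 hbL p Ψ'
  have hGS : periodicGroundStateEnergy (scaledPotential u b) (m + 1) L₁ =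
      (ENNReal.ofReal (b ^ 2))⁻¹ * periodicGroundStateEnergy u (m + 1) L' := by
    have h := periodicGroundStateEnergy_scaledPotential (M := L') hb0 u (m + 1)
    rwa [← hbL] at h
  have hΦsc : periodicEnergy (scaledPotential u b) Φ ≤
      periodicGroundStateEnergy (scaledPotential u b) (m + 1) L₁ + ENNReal.ofReal δh := by
    rw [hΦ, periodicEnergy_dilate hb0 hbL u Ψ', hGS, hE Ψ', hE₀ L']
    calc (ENNReal.ofReal (b ^ 2))⁻¹ * periodicEnergy v Ψ'
        ≤ (ENNReal.ofReal (b ^ 2))⁻¹ * (periodicGroundStateEnergy v (m + 1) L' +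
            ENNReal.ofReal (b ^ 2) * ENNReal.ofReal δh) := by gcongr
      _ = (ENNReal.ofReal (b ^ 2))⁻¹ * periodicGroundStateEnergy v (m + 1) L' + ENNReal.ofReal δh := by
          rw [mul_add, ← mul_assoc, ENNReal.inv_mul_cancel hb2 ENNReal.ofReal_ne_top, one_mul]
  -- the two interactions on the torus of side `L₁` are `N²ε'C`-close both ways
  have hper1 : ∀ y : Space, periodizedPotential (scaledPotential u b) L₁ y ≤
      periodizedPotential u L₁ y + ENNReal.ofReal ε' * C := fun y =>
    (vb_periodizedPotential_le_of_pointwise (fun x => (hηT b hb1 x).1) L₁ y).trans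
      (add_le_add le_rfl (mul_le_mul' le_rfl (hC' y)))
  have hper2 : ∀ y : Space, periodizedPotential u L₁ y ≤
      periodizedPotential (scaledPotential u b) L₁ y + ENNReal.ofReal ε' * C := fun y =>
    (vb_periodizedPotential_le_of_pointwise (fun x => (hηT b hb1 x).2) L₁ y).trans
      (add_le_add le_rfl (mul_le_mul' le_rfl (hC' y)))
  have hint1 := fun X : Config (m + 1) => vb_periodicInteraction_le_of_periodized_le hper1 X
  have hint2 := fun X : Config (m + 1) => vb_periodicInteraction_le_of_periodized_le hper2 X
  -- so `Φ` and `Ψ₁` are `δ`-near-minimisers of `u` at `(N, L₁)`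
  have hΦnear : periodicEnergy u Φ ≤ periodicGroundStateEnergy u (m + 1) L₁ + δ :=
    calc periodicEnergy u Φ
        ≤ periodicEnergy (scaledPotential u b) Φ +
            (((m + 1) * (m + 1) : ℕ) : ℝ≥0∞) * (ENNReal.ofReal ε' * C) :=
          vb_periodicEnergy_le_of_interaction_le hint2 Φ
      _ ≤ periodicGroundStateEnergy (scaledPotential u b) (m + 1) L₁ + ENNReal.ofReal δh +
            (((m + 1) * (m + 1) : ℕ) : ℝ≥0∞) * (ENNReal.ofReal ε' * C) := add_le_add hΦsc le_rfl
      _ ≤ periodicGroundStateEnergy u (m + 1) L₁ +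
            (((m + 1) * (m + 1) : ℕ) : ℝ≥0∞) * (ENNReal.ofReal ε' * C) + ENNReal.ofReal δh +
            (((m + 1) * (m + 1) : ℕ) : ℝ≥0∞) * (ENNReal.ofReal ε' * C) :=
          add_le_add (add_le_add (vb_groundStateEnergy_le_of_interaction_le hint1) le_rfl) le_rfl
      _ = periodicGroundStateEnergy u (m + 1) L₁ +
            (2 * ((((m + 1) * (m + 1) : ℕ) : ℝ≥0∞) * (ENNReal.ofReal ε' * C)) + ENNReal.ofReal δh) := by
          ring
      _ ≤ periodicGroundStateEnergy u (m + 1) L₁ + (ENNReal.ofReal δh + ENNReal.ofReal δh) :=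
          add_le_add le_rfl (add_le_add hD le_rfl)
      _ = periodicGroundStateEnergy u (m + 1) L₁ + ENNReal.ofReal δ' := by
          rw [← ENNReal.ofReal_add hδh0.le hδh0.le, hδh, add_halves]
      _ ≤ periodicGroundStateEnergy u (m + 1) L₁ + δ := add_le_add le_rfl hδ'
  have hΨ₁near : periodicEnergy u Ψ₁ ≤ periodicGroundStateEnergy u (m + 1) L₁ + δ := by
    rw [hE, hE₀]
    exact hΨ₁.trans (add_le_add le_rfl hδ')
  have h := hδ Φ Ψ₁ hΦnear hΨ₁near
  rwa [hmass] at h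

end Summit.AtomisticToContinuum.BoseEinsteinCondensation.Cruxes.GDTransfer.Seeded

end
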